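import Summits.ResolutionOfSingularities.ResolutionOfSingularities.Theorems.PurelyInseparableDim4WinCertLeafKinds2
import HarnessLib
import HarnessLib.Audit.Tags

/-!
# Purely inseparable fourfolds — FCert v3: the GCD leaf WITH CONSTANTS «x_T = c_T, h(x − c) = 0» by translating p-8's
# `gcdLeafB`, and the leaf oracle `leafOK5` (subst | norm | laurent | gcd | gcdC)
# [OURS · counted 0 · a certificate format for OUR frame v4, not about resolution]

Census cell «res-dim4-pi» (D-0157 DOOR 2), desk WORDS #111 (b) / #113 (d); seat res-rescue-typ-3 g9.  Sequel of
`…WinCertLeafKinds2` (`leafOK4`).  res-dim4-p-8 g4's GCD leaf (`gcdLeafB` / `not_inCoordinateScope_translate_of_gcdLeaf`,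
`…ScopeBlindGcdLeaf{,Cert}`) certifies the loci `{x_T = 0, h = 0}`; the seat's census (kit j323423) meets components on
TRANSLATED coordinate subspaces `{x_t = 1}` (4 further band roots).  No new blindness argument: translate the chart transform
by the constant vector `c` FIRST (`StepKit.transAll`) and certify there.

* §1 `not_inCoordinateScope_translate_map_of_gcdLeafB` — p-8's `not_inCoordinateScope_step_map_of_gcdLeafB` for an
  ARBITRARY term list `G` in place of the chart transform (his proof, minus the chart rewrite).
* §2 `gcdConstLeafB p s S j c T h cof bez α₀ := gcdLeafB p (transAll c (chartL p S j s.L)) T h cof bez α₀`; **`gcdConst_children_blind`**: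
  over every field `K` of characteristic `p`, along every `f`, at every centre point `b` of chart `j` with `b_T = f(c_T)` and
  `h(b − f∘c) = 0`, the child `CentreBlowup.step p S j b (s ⊗ K)` is OUT of coordinate scope.
* §3 `LeafCert5 = subst | norm | laurent | gcd | gcdC c T h cof bez α₀`, link `gcdConstLinkB` (`x_t − c_t ∈ gens` for
  `t ∈ T` unless `t = j` and `c_j = 0`; `h(x − c) ∈ gens`, both up to collecting terms), oracle **`leafOK5`**,
  **`leafSound5 : LeafSound 2 leafOK5`**, `forall_inScopeStateWins_of_lwinCertBL5`.
Nothing here proves resolution of singularities in dimension ≥ 4 / characteristic `p`; F4-C(2,2) stays OPEN; counted 0;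
AI work, weaker than expert review.  bears_on: LADDER-RESOLUTION:D157-DOOR2 (res-dim4-pi · F4-C ∀K column · FCert v3
leaf kinds). Supports stmt-ResolutionOfSingularities-16155 (helper).
-/

set_option linter.dupNamespace false

noncomputable section
open MvPolynomial Finset
open scoped BigOperators
namespace Summit.ResolutionOfSingularities.ResolutionOfSingularities.Theorems.PIDim4

namespace WinCertLeaf

open Literature.AlgebraicGeometry.Resolution
open Literature.AlgebraicGeometry.Resolution.CentreBlowup
open Literature.AlgebraicGeometry.Resolution.Hauser2010
open StepKit WinCertSound InScopeWinCert ScopeCover ScopeDynamics ScopeBlind WinCertAllFields WinCertFlat WinCertSubst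

variable {k : Type} [Field k] [DecidableEq k]

/-! ## §1 p-8's GCD certificate for an arbitrary term list -/

/-- **`gcdLeafB` soundness for an arbitrary term list `G`** (p-8's `not_inCoordinateScope_step_map_of_gcdLeafB` without
the chart-transform wrapper): at every `b` with `b_T = 0` and `h(b) = 0`, the translate of `G ⊗ K` to `b` is OUT of
coordinate scope. [folklore] -/
theorem not_inCoordinateScope_translate_map_of_gcdLeafB {p : ℕ} [Fact p.Prime] {G : Terms 4 k} {T : Finset (Fin 4)}
    {h : Terms 4 k} {cof : (Fin 4 → ℕ) → Terms 4 k} {bez : Fin 4 → List ((Fin 4 → ℕ) × Terms 4 k)} {α₀ : Fin 4 → ℕ}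
    (hc : gcdLeafB p G T h cof bez α₀ = true)
    (K : Type) [Field K] [CharP K p] [DecidableEq K] (f : k →+* K) (b : Fin 4 → K) (hbT : ∀ i ∈ T, b i = 0)
    (hbh : MvPolynomial.eval b (MvPolynomial.map f (evalT h)) = 0) :
    ¬ InCoordinateScope p (PointBlowup.translate b (MvPolynomial.map f (evalT G))) := by
  classical
  simp only [gcdLeafB, Bool.and_eq_true, decide_eq_true_eq, List.all_eq_true, Bool.not_eq_true'] at hc
  obtain ⟨⟨⟨⟨hfree, hJ⟩, hbez⟩, hα₀⟩, hW⟩ := hc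
  have hdeg : (expo α₀).degree = ∑ i, α₀ i := degree_expo α₀
  -- `h` is free of `x_T`
  have hhT : MvPolynomial.aeval (R := K) (fun i : Fin 4 => if i ∈ T then (0 : MvPolynomial (Fin 4) K) else X i)
      (MvPolynomial.map f (evalT h)) = MvPolynomial.map f (evalT h) := by
    have hfilt : (h.filter fun t => ∀ i ∈ T, t.1 i = 0) = h := List.filter_eq_self.mpr fun t ht => decide_eq_true (hfree t ht)
    rw [aeval_killT_map, aeval_killT_evalT, hfilt]
  -- certificate (i)
  have hJK : ∀ α : Fin 4 →₀ ℕ, 0 < α.degree → α.degree < p → ∃ c : MvPolynomial (Fin 4) K,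
      MvPolynomial.aeval (R := K) (fun i : Fin 4 => if i ∈ T then (0 : MvPolynomial (Fin 4) K) else X i)
        (hasseDeriv α (MvPolynomial.map f (evalT G))) = c * MvPolynomial.map f (evalT h) := by
    intro α h0 hq
    refine ⟨MvPolynomial.map f (evalT (cof ⇑α)), ?_⟩
    have hz := hJ (⇑α) (mem_idxLT h0 hq)
    rw [← evalT_eq_iff_equivB, killTL, ← aeval_killT_evalT, evalT_mulL, ← hasseDeriv_evalT, expo_coe] at hz
    have hzK := congrArg (MvPolynomial.map f) hz
    rw [← aeval_killT_map, ← IsolationConverse.hasseDeriv_map, map_mul] at hzK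
    exact hzK
  -- certificate (ii)
  have hXK : ∀ i : Fin 4, i ∉ T → ∀ β : K,
      MvPolynomial.aeval (R := K) (fun j : Fin 4 => if j = i then C β else (X j : MvPolynomial (Fin 4) K))
        (MvPolynomial.map f (evalT h)) ≠ 0 :=
    fun i hiT β => aeval_freeze_ne_zero_of_bezoutB f i h (bez i) (hbez i hiT) β
  -- certificate (iii)
  have hWK : MvPolynomial.aeval (R := K) (fun i : Fin 4 => if i ∈ T then (0 : MvPolynomial (Fin 4) K) else X i)
      (hasseDeriv (expo α₀) (MvPolynomial.map f (evalT G))) ≠ 0 := by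
    rw [IsolationConverse.hasseDeriv_map, aeval_killT_map, hasseDeriv_evalT, aeval_killT_evalT]
    intro h0
    apply (not_congr (evalT_eq_zero_iff _)).mpr (by rw [killTL] at hW; rw [hW]; exact Bool.false_ne_true)
    exact (map_eq_zero_iff _ (MvPolynomial.map_injective f f.injective)).mp h0
  exact not_inCoordinateScope_translate_of_gcdLeaf (MvPolynomial.map f (evalT G)) (MvPolynomial.map f (evalT h)) T hhT
    hJK hXK (expo α₀) (by rw [hdeg]; exact hα₀.1) (by rw [hdeg]; exact hα₀.2) hWK b hbT hbh

omit [DecidableEq k] in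
/-- Translation commutes with the coefficient map: `(G(x + c)) ⊗ K = (G ⊗ K)(x + f c)`. [folklore] -/
theorem map_translate_comm' {K : Type} [Field K] (f : k →+* K) (c : Fin 4 → k) (G : MvPolynomial (Fin 4) k) :
    MvPolynomial.map f (PointBlowup.translate c G) = PointBlowup.translate (f ∘ c) (MvPolynomial.map f G) := by
  have hg : (fun i => MvPolynomial.map f (X i + C (c i) : MvPolynomial (Fin 4) k)) =
      fun i => (X i + C ((f ∘ c) i) : MvPolynomial (Fin 4) K) := by
    funext i
    rw [map_add, MvPolynomial.map_X, MvPolynomial.map_C, Function.comp_apply]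
  unfold PointBlowup.translate
  rw [MvPolynomial.aeval_eq_bind₁, MvPolynomial.aeval_eq_bind₁, MvPolynomial.map_bind₁, hg]

/-! ## §2 The constant-shifted GCD leaf -/

/-- **`gcdConstLeafB p s S j c T h cof bez α₀`** — p-8's GCD certificate on the chart transform TRANSLATED by the
constant vector `c`. [OURS · instrument] -/
def gcdConstLeafB (p : ℕ) (s : SData 4 k) (S : Finset (Fin 4)) (j : Fin 4) (c : Fin 4 → k) (T : Finset (Fin 4))
    (h : Terms 4 k) (cof : (Fin 4 → ℕ) → Terms 4 k) (bez : Fin 4 → List ((Fin 4 → ℕ) × Terms 4 k)) (α₀ : Fin 4 → ℕ) :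
    Bool :=
  gcdLeafB p (transAll c (chartL p S j s.L)) T h cof bez α₀

/-- **THE CONSTANT-SHIFTED GCD LEAF.**  If `gcdConstLeafB p s S j c T h cof bez α₀` checks, then over EVERY field `K` of
characteristic `p`, along every `f`, at every `b` with `b_t = f (c_t)` for `t ∈ T` and `h(b − f∘c) = 0`, the child
`CentreBlowup.step p S j b (s ⊗ K)` is OUT of coordinate scope. [OURS · ‖ K] -/
theorem gcdConst_children_blind {p : ℕ} [Fact p.Prime] {s : SData 4 k} {S : Finset (Fin 4)} {j : Fin 4}
    {c : Fin 4 → k} {T : Finset (Fin 4)} {h : Terms 4 k} {cof : (Fin 4 → ℕ) → Terms 4 k}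
    {bez : Fin 4 → List ((Fin 4 → ℕ) × Terms 4 k)} {α₀ : Fin 4 → ℕ} (hc : gcdConstLeafB p s S j c T h cof bez α₀ = true)
    (K : Type) [Field K] [CharP K p] [DecidableEq K] (f : k →+* K) (b : Fin 4 → K)
    (hbT : ∀ i ∈ T, b i = f (c i))
    (hbh : MvPolynomial.eval (b - f ∘ c) (MvPolynomial.map f (evalT h)) = 0) :
    ¬ InCoordinateScope p
      (CentreBlowup.step p S j b (⟨MvPolynomial.map f s.toState.F, s.toState.r, s.toState.exc⟩ : State K)).F := by
  classical
  have hb'T : ∀ i ∈ T, (b - f ∘ c) i = 0 := fun i hi => by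
    rw [Pi.sub_apply, Function.comp_apply, hbT i hi, sub_self]
  have hblind := not_inCoordinateScope_translate_map_of_gcdLeafB hc K f (b - f ∘ c) hb'T hbh
  have hpoly : PointBlowup.translate (b - f ∘ c) (MvPolynomial.map f (evalT (transAll c (chartL p S j s.L)))) =
      PointBlowup.translate b (chartTransform p S j (MvPolynomial.map f s.toState.F)) := by
    rw [← translate_evalT, map_translate_comm', ← FlatAbsorb.translate_add,
      show f ∘ c + (b - f ∘ c) = b from add_sub_cancel (f ∘ c) b, SData.toState_F,
      WinCertAllFields.chartTransform_map, chartTransform_evalT]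
  rw [hpoly] at hblind
  have hF : (CentreBlowup.step p S j b (⟨MvPolynomial.map f s.toState.F, s.toState.r, s.toState.exc⟩ : State K)).F =
      deletePthPowers p (PointBlowup.translate b (chartTransform p S j (MvPolynomial.map f s.toState.F))) := rfl
  unfold InCoordinateScope at hblind ⊢
  rw [hF, IsolatedBand.singLocusIdeal_deletePthPowers]
  exact hblind

/-! ## §3 The oracle with the fifth kind -/

/-- A leaf certificate: substitution | norm | Laurent | GCD | GCD with constants. [folklore] -/
inductive LeafCert5 (k : Type) where
  /-- p-8's substitution leaf -/
  | subst (σ : Fin 4 → Terms 4 k) (T : Finset (Fin 4)) (α₀ : Fin 4 → ℕ) : LeafCert5 k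
  /-- p-8's norm leaf (`p = 2`) -/
  | norm (T : Finset (Fin 4)) (u v : Fin 4) (α₀ : Fin 4 → ℕ) : LeafCert5 k
  /-- p-8's Laurent leaf -/
  | laurent (T : Finset (Fin 4)) (m : Fin 4) (aL cL : Terms 4 k) (cert : (Fin 4 → ℕ) → ℕ × Terms 4 k)
      (α₀ : Fin 4 → ℕ) : LeafCert5 k
  /-- p-8's GCD leaf -/
  | gcd (T : Finset (Fin 4)) (h : Terms 4 k) (cof : (Fin 4 → ℕ) → Terms 4 k)
      (bez : Fin 4 → List ((Fin 4 → ℕ) × Terms 4 k)) (α₀ : Fin 4 → ℕ) : LeafCert5 k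
  /-- the GCD leaf on the chart transform translated by the constant vector `c` -/
  | gcdC (c : Fin 4 → k) (T : Finset (Fin 4)) (h : Terms 4 k) (cof : (Fin 4 → ℕ) → Terms 4 k)
      (bez : Fin 4 → List ((Fin 4 → ℕ) × Terms 4 k)) (α₀ : Fin 4 → ℕ) : LeafCert5 k

/-- **The link for a constant-shifted GCD leaf**: for `t ∈ T`, either `t` is the chart variable with `c_t = 0`, or
`x_t − c_t ∈ gens`; and `h(x − c) ∈ gens` — both up to collecting terms. [folklore] -/
def gcdConstLinkB {C : Type} (ℓ : ILeaf k C) (c : Fin 4 → k) (T : Finset (Fin 4)) (h : Terms 4 k) : Bool :=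
  decide (∀ t ∈ T, (t = ℓ.j ∧ c t = 0) ∨
    ∃ g ∈ ℓ.gens, StepKit.equivB (normL g) (normL ([(unitE t 1, (1 : k)), (fun _ => 0, -(c t))] : Terms 4 k)) = true) &&
    decide (∃ g ∈ ℓ.gens, StepKit.equivB (normL g) (normL (transAll (-c) h)) = true)

omit [DecidableEq k] in
/-- From the link and the leaf conditions: `b_T = f(c_T)` and `h(b − f∘c) = 0`. [folklore] -/
theorem gcdConst_hyps_of_linkB {C : Type} {K : Type} [Field K] (f : k →+* K) {ℓ : ILeaf k C} {c : Fin 4 → k}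
    {T : Finset (Fin 4)} {h : Terms 4 k} [DecidableEq k] (hlink : gcdConstLinkB ℓ c T h = true) {b : Fin 4 → K}
    (hbj : b ℓ.j = 0) (hon : OnLeaf f ℓ b) :
    (∀ i ∈ T, b i = f (c i)) ∧ MvPolynomial.eval (b - f ∘ c) (MvPolynomial.map f (evalT h)) = 0 := by
  classical
  unfold gcdConstLinkB at hlink
  simp only [Bool.and_eq_true, decide_eq_true_eq] at hlink
  obtain ⟨hT, ⟨g, hg, hge⟩⟩ := hlink
  refine ⟨fun i hi => ?_, ?_⟩
  · rcases hT i hi with ⟨rfl, hc0⟩ | ⟨g', hg', hge'⟩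
    · rw [hbj, hc0, map_zero]
    · have hz := hon.1 g' hg'
      rw [eval₂Hom_eq_of_equivB_normL f b hge'] at hz
      simp only [evalT_cons, evalT_nil, map_add, add_zero, eval₂Hom_monomial_expo, prod_pow_unitE, pow_one, map_one,
        one_mul, map_neg, pow_zero, Finset.prod_const_one, mul_one] at hz
      linear_combination hz
  · have hz := hon.1 g hg
    rw [eval₂Hom_eq_of_equivB_normL f b hge, ← translate_evalT, MvPolynomial.coe_eval₂Hom, ← MvPolynomial.eval_map,
      map_translate_comm', CurveBlind.eval_translate_add] at hz
    have hc : (b + ⇑f ∘ (-c)) = b - ⇑f ∘ c := by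
      funext l; simp [sub_eq_add_neg]
    rwa [hc] at hz

/-- **THE LEAF ORACLE at `p = 2`** with five kinds. [folklore] -/
def leafOK5 (s : SData 4 (ZMod 2)) (S : Finset (Fin 4)) (ℓ : ILeaf (ZMod 2) (LeafCert5 (ZMod 2))) : Bool :=
  match ℓ.cert with
  | .subst σ T α₀ => ℓ.opens.isEmpty && substLinkB ℓ σ && substBlindB 2 (chartL 2 S ℓ.j s.L) σ T α₀
  | .norm T u v α₀ => ℓ.opens.isEmpty && normLinkB ℓ T u v && normLeafB s S ℓ.j T u v α₀
  | .laurent T m aL cL cert α₀ => laurentLinkB ℓ T m aL cL && laurentBlindB 2 (chartL 2 S ℓ.j s.L) T m aL cL cert α₀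
  | .gcd T h cof bez α₀ => gcdLinkB ℓ T h && gcdLeafB 2 (chartL 2 S ℓ.j s.L) T h cof bez α₀
  | .gcdC c T h cof bez α₀ => gcdConstLinkB ℓ c T h && gcdConstLeafB 2 s S ℓ.j c T h cof bez α₀

/-- **SOUNDNESS OF THE ORACLE `leafOK5`.** [folklore] -/
theorem leafSound5 : LeafSound 2 leafOK5 := by
  classical
  intro s S ℓ hok K _ _ _ f b hbj hon
  obtain ⟨j, gens, opens, cert⟩ := ℓ
  cases cert with
  | subst σ T α₀ =>
    simp only [leafOK5, Bool.and_eq_true] at hok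
    obtain ⟨⟨-, hlink⟩, hsub⟩ := hok
    exact not_inCoordinateScope_step_map_of_substBlindB hsub K f b (eval_map_eq_of_substLinkB f hlink hbj hon)
  | norm T u v α₀ =>
    simp only [leafOK5, Bool.and_eq_true] at hok
    obtain ⟨⟨-, hlink⟩, hnorm⟩ := hok
    obtain ⟨hT, hQ⟩ := norm_hyps_of_normLinkB f hlink hbj hon
    have hf : f = ZMod.castHom (dvd_refl 2) K := Subsingleton.elim _ _
    subst hf
    exact children_blind_of_normLeafB hnorm K b hT hQ
  | laurent T m aL cL cert α₀ =>
    simp only [leafOK5, Bool.and_eq_true] at hok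
    obtain ⟨hlink, hlau⟩ := hok
    obtain ⟨hT, hab, hZ⟩ := laurent_hyps_of_linkB f hlink hbj hon
    exact not_inCoordinateScope_step_map_of_laurentBlindB hlau K f b hT hab hZ
  | gcd T h cof bez α₀ =>
    simp only [leafOK5, Bool.and_eq_true] at hok
    obtain ⟨hlink, hg⟩ := hok
    obtain ⟨hT, hh⟩ := gcd_hyps_of_linkB f hlink hbj hon
    exact not_inCoordinateScope_step_map_of_gcdLeafB hg K f b hT hh
  | gcdC c T h cof bez α₀ =>
    simp only [leafOK5, Bool.and_eq_true] at hok
    obtain ⟨hlink, hg⟩ := hok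
    obtain ⟨hT, hh⟩ := gcdConst_hyps_of_linkB f hlink hbj hon
    exact gcdConst_children_blind hg K f b hT hh

/-- **`∀ K` form for the five kinds.** [folklore] -/
theorem forall_inScopeStateWins_of_lwinCertBL5 {T : LCert (ZMod 2) (LeafCert5 (ZMod 2))}
    (h : lwinCertBL 2 2 leafOK5 T = true) (K : Type) [Field K] [CharP K 2] [DecidableEq K] :
    ∀ row ∈ T, InScopeStateWins 2
      (⟨MvPolynomial.map (ZMod.castHom (dvd_refl 2) K) row.1.1.toState.F, row.1.1.toState.r,
        row.1.1.toState.exc⟩ : State K) :=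
  forall_inScopeStateWins_of_lwinCertBL leafSound5 h K

end WinCertLeaf

end Summit.ResolutionOfSingularities.ResolutionOfSingularities.Theorems.PIDim4

end
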